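import Literature.Analysis.FluidPDE.PlanarLinearFrame
import HarnessLib

/-!
# Conjugate elements: reading an explicit move through a linear frame

Topic `Literature/Analysis/FluidPDE`. Element file of the explicit pullback calculus for the
planar transport equation. Every element type is written once in a preferred frame (runs
horizontal, corners as graphs over `u = x - y`); the other orientations are its CONJUGATES by an
invertible linear frame `A` (`PlanarLinearFrame.lean`): for an element triple `(Θ, V, H)` —
scalar, velocity, stream function —

* `conjScalar A Θ t z = Θ(t, A z)`, `conjVelocity A V t z = A⁻¹ V(t, A z)`,
  `conjStream A H t z = det(A)⁻¹ H(t, A z)`.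

Transport, the stream-function form `V = ∇⊥H`, joint smoothness, band containment, bounds and
vanishing all pass to the conjugate (`transport_conj…`, `conjVelocity_eq_perpGrad_conjStream`,
…). With `A = swap` a horizontal run becomes a vertical run; with `A = flipY` a corner turning
south becomes a corner turning north.

Folklore; no named facts. Infrastructure towards a discharge of `acm_compatible_blocks`
(`QuasiSelfSimilarCompatibleBlocks.lean`).

## References

* G. Alberti, G. Crippa, A. L. Mazzucato, *Exponential self-similar mixing by incompressible
  flows*, J. Amer. Math. Soc. 32 (2019), 445–490, §7 (arXiv:1605.02090).
-/

noncomputable section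

open Function Set Filter
open scoped Topology ContDiff

namespace Literature.Analysis.FluidPDE

namespace PlanarKinematics

/-- The plane `ℝ²` as a Euclidean space. [folklore] -/
local notation "E²" => EuclideanSpace ℝ (Fin 2)

variable {G : Type*} [NormedAddCommGroup G] [NormedSpace ℝ G]

namespace LinFrame

variable (A : LinFrame)

/-- **Conjugate scalar** `Θ(t, A z)`. [folklore] -/
def conjScalar (Θ : ℝ → E² → G) (t : ℝ) (z : E²) : G := Θ t (A.app z)

/-- **Conjugate velocity** `A⁻¹ V(t, A z)`. [folklore] -/
def conjVelocity (V : ℝ → E² → E²) (t : ℝ) (z : E²) : E² := A.inv (V t (A.app z))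

/-- **Conjugate stream function** `det(A)⁻¹ H(t, A z)`. [folklore] -/
def conjStream (H : ℝ → E² → ℝ) (t : ℝ) (z : E²) : ℝ := A.det⁻¹ * H t (A.app z)

omit [NormedAddCommGroup G] [NormedSpace ℝ G] in
/-- Unfolding the conjugate scalar. [folklore] -/
theorem conjScalar_apply (Θ : ℝ → E² → G) (t : ℝ) (z : E²) : A.conjScalar Θ t z = Θ t (A.app z) := rfl

/-- Unfolding the conjugate velocity. [folklore] -/
theorem conjVelocity_apply (V : ℝ → E² → E²) (t : ℝ) (z : E²) : A.conjVelocity V t z = A.inv (V t (A.app z)) := rfl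

/-- Unfolding the conjugate stream function. [folklore] -/
theorem conjStream_apply (H : ℝ → E² → ℝ) (t : ℝ) (z : E²) : A.conjStream H t z = A.det⁻¹ * H t (A.app z) := rfl

/-! ## Transport, stream function, smoothness -/

/-- **Transport passes to the conjugate**: if `(Θ, V)` has vanishing transport expression at
`(t, A z)` (and `Θ(t,·)` is differentiable there), the conjugate pair has vanishing transport
expression at `(t, z)`. [folklore] -/
theorem transport_conjScalar {Θ : ℝ → E² → G} {V : ℝ → E² → E²} {t : ℝ} {z : E²}
    (hΘ : DifferentiableAt ℝ (Θ t) (A.app z))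
    (h : deriv (fun s => Θ s (A.app z)) t + fderiv ℝ (Θ t) (A.app z) (V t (A.app z)) = 0) :
    deriv (fun s => A.conjScalar Θ s z) t + fderiv ℝ (A.conjScalar Θ t) z (A.conjVelocity V t z) = 0 :=
  A.transport_conj hΘ h

/-- **The stream-function form passes to the conjugate**: if `V(t, ·) = ∇⊥H(t, ·)` at `A z`
(with `H(t,·)` differentiable there), then `conjVelocity = ∇⊥ conjStream` at `z`. [folklore] -/
theorem conjVelocity_eq_perpGrad_conjStream {V : ℝ → E² → E²} {H : ℝ → E² → ℝ} {t : ℝ} {z : E²}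
    (hH : DifferentiableAt ℝ (H t) (A.app z)) (hV : V t (A.app z) = perpGrad (H t) (A.app z)) :
    A.conjVelocity V t z = perpGrad (A.conjStream H t) z := by
  rw [conjVelocity_apply, hV, A.conj_perpGrad hH]
  rfl

/-- **The conjugate scalar is smooth.** [folklore] -/
theorem contDiff_uncurry_conjScalar {Θ : ℝ → E² → G} (hΘ : ContDiff ℝ ∞ (uncurry Θ)) :
    ContDiff ℝ ∞ (uncurry (A.conjScalar Θ)) :=
  A.contDiff_uncurry_comp hΘ

/-- **The conjugate velocity is smooth.** [folklore] -/
theorem contDiff_uncurry_conjVelocity {V : ℝ → E² → E²} (hV : ContDiff ℝ ∞ (uncurry V)) :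
    ContDiff ℝ ∞ (uncurry (A.conjVelocity V)) :=
  A.contDiff_uncurry_conj hV

/-- **The conjugate stream function is smooth.** [folklore] -/
theorem contDiff_uncurry_conjStream {H : ℝ → E² → ℝ} (hH : ContDiff ℝ ∞ (uncurry H)) :
    ContDiff ℝ ∞ (uncurry (A.conjStream H)) :=
  contDiff_const.mul (A.contDiff_uncurry_comp hH)

/-- Slices of the conjugate scalar are differentiable where the slices of `Θ` are. [folklore] -/
theorem differentiableAt_conjScalar {Θ : ℝ → E² → G} {t : ℝ} {z : E²} (hΘ : DifferentiableAt ℝ (Θ t) (A.app z)) :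
    DifferentiableAt ℝ (A.conjScalar Θ t) z :=
  A.differentiableAt_comp hΘ

/-! ## Bands, bounds, vanishing -/

omit [NormedSpace ℝ G] in
/-- **Band containment passes to the conjugate**: if `Θ(t, w) ≠ 0` forces `w ∈ S`, then
`conjScalar Θ (t, z) ≠ 0` forces `A z ∈ S`. [folklore] -/
theorem app_mem_of_conjScalar_ne_zero {Θ : ℝ → E² → G} {S : Set E²} {t : ℝ} {z : E²}
    (hS : ∀ w, Θ t w ≠ 0 → w ∈ S) (hne : A.conjScalar Θ t z ≠ 0) : A.app z ∈ S :=
  hS _ hne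

/-- **Bounds pass to the conjugate.** [folklore] -/
theorem abs_conjScalar_le {Θ : ℝ → E² → ℝ} {M : ℝ} {t : ℝ} (hM : ∀ w, |Θ t w| ≤ M) (z : E²) :
    |A.conjScalar Θ t z| ≤ M := hM _

/-- **Vanishing passes to the conjugate velocity.** [folklore] -/
theorem conjVelocity_eq_zero {V : ℝ → E² → E²} {t : ℝ} {z : E²} (hV : V t (A.app z) = 0) :
    A.conjVelocity V t z = 0 := by
  rw [conjVelocity_apply, hV, ← A.invL_apply, map_zero]

omit [NormedSpace ℝ G] in
/-- **Vanishing passes to the conjugate scalar.** [folklore] -/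
theorem conjScalar_eq_zero {Θ : ℝ → E² → G} {t : ℝ} {z : E²} (hΘ : Θ t (A.app z) = 0) :
    A.conjScalar Θ t z = 0 := hΘ

/-- **Local agreement passes to the conjugates**: if two scalars agree at `A z`, their conjugates
agree at `z` (used for the junction identities of conjugate elements). [folklore] -/
theorem conjScalar_congr {Θ Θ' : ℝ → E² → ℝ} {t : ℝ} {z : E²} (h : Θ t (A.app z) = Θ' t (A.app z)) :
    A.conjScalar Θ t z = A.conjScalar Θ' t z := h

/-- Local agreement of stream functions passes to the conjugates. [folklore] -/
theorem conjStream_congr {H H' : ℝ → E² → ℝ} {t : ℝ} {z : E²} (h : H t (A.app z) = H' t (A.app z)) :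
    A.conjStream H t z = A.conjStream H' t z := by
  rw [conjStream_apply, conjStream_apply, h]

end LinFrame

end PlanarKinematics

end Literature.Analysis.FluidPDE
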